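/-
Copyright (c) 2026 the pub-hodgecm-mathlib formalisation cell (harness21).  Prover seat hodgecm-mathlib-K2E3-p17 (g0) (WILD ENGINE line lead, K2E3-plan (g1) BATCH #2),
Track B «K2-LIT» ∕ h413, unit U5Kazhdan of the line `K2_E3_EllipticInputs`: the WILD twin of E1 «58-WITNESS-RAM» (the K1 spine's witness; next: T2b∕T3-W pays 17W).  2026-09-03.
-/
import Summits.HodgeConjecture.HodgeConjecture.Theorems.K2E3CharacterEllipticUniformWild           -- ★ H-W p855220 (K2E3-p15): (e) `char_eq_fixedVertexSum_sub_fixedEdgeSum_of_ramificationIdx_ne_one`; brings ★ H-RAM ∕ H (a) `_of_involution`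
import Summits.HodgeConjecture.HodgeConjecture.Theorems.K2E3EllipticFixedTreeWild                   -- ★ B3(53)-W p855224 (this seat): (c) `ellipticFixedTree_of_mem_ellG_of_ramificationIdx_ne_one`
import Summits.HodgeConjecture.HodgeConjecture.Theorems.K2E3EPFunctionOrbitalEllipticWild           -- ★ 48-W∕2 (K2E4-p21): (d) `classOrbitalIntegral_epSum_eq_fixedVertexSum_sub_fixedEdgeSum_of_ramificationIdx_ne_one`
import Summits.HodgeConjecture.HodgeConjecture.Theorems.F0P3cStCharTSK1PseudoCoeffWitnessRamified   -- ★ 58-WITNESS-RAM p853641 (LH5-p04): the tame twin (brings ★ (G3), ★ (G4) pin reader, ★ 47e-E3, ★ JDIM2, ★ rows 42∕51, ★ `cmPrincipalSeries`)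
import HarnessLib

/-!
# K2_E3 road (h413 = stmt-HodgeConjecture-24833), unit U5Kazhdan — THE WILD ENGINE, K1 spine, FILE «58-W-W»: the Schneider–Stuhler Euler–Poincaré pseudo-coefficient of a
# GENERAL irreducible class of `U(Φ₃)(L⁺_v)`, explicit letters, AT EVERY RAMIFIED PLACE (tame re-proved, WILD = dyadic new)

Cell `pub/hodgecm-mathlib` (D-0151), Track B; seat K2E3-p17 (g0) = WILD ENGINE LINE LEAD (K2E3-plan (g1) DEALS BATCH #2 22:15:20Z; FILE ↦ SEAT MAP 22:22:15Z).
THEOREMS ONLY (no definition ∕ instance ∕ notation ∕ named fact ∕ `sorry`); ★-only imports (never a `Cruxes/…/Lines` module).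

WHAT.  The WILD twin of ★ 58-WITNESS-RAM `F0P3cStCharTSK1PseudoCoeffWitnessRamified.isPseudoCoeff_epFunction_of_neg_explicit` (p853641): the same statement with the tame
block `(hσ hvσ hϖ hσϖ hres h2 hnorm)` replaced IN ITS SLOT by `(hram : e(w∣v) ≠ 1) (hϖ)`, `h61` and the conclusion VERBATIM — so the witnessed K1 («the displayed Euler–Poincaré
function of `r`'s `K`-types on the base edge is a pseudo-coefficient of `⟦r⟧`») now holds at the WILD (dyadic ramified) places too.  Proof = the tame proof with its three
tame calls swapped for the ★ wild twins (53-W, 48-W∕2, H-W) — the mechanical layer above (S)-WILD (★ p855217, K2E3-p21), exactly as the FILE ↦ SEAT MAP says.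
* §1 **`isPseudoCoeff_epFunction_of_ramificationIdx_ne_one_explicit`**.
Consumer: T2b∕T3-W `Theorems/K2E3PseudoCoeffExistsNonScWild.lean` (this seat, next) = the 17W engine socket `sig_K2E3PseudoCoeffExistsNonScWild` PAID BY NAME (with 61b-W for `h61`),
whence row #17 `sig_K2E3PseudoCoeffExistsElliptic` by ★ p855141 `pseudoCoeffExistsElliptic_of_nonScWild`.

HONEST LABEL: HC_CM is proved only modulo the 7 printed citations (2 remaining named inputs: hLiu418 = stmt-HodgeConjecture-24832, h413 =
stmt-HodgeConjecture-24833) until rung 0 closes; `--supports stmt-HodgeConjecture-24833` helper (a brick of row #17's wild residue); retires nothing by itself.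

## References
* [SchneiderStuhler1997] P. Schneider, U. Stuhler, *Representation theory and sheaves on the Bruhat–Tits building*, Publ. Math. IHÉS 85 (1997): Thm. III.4.16, §III.4.
* [Kottwitz1988] R. E. Kottwitz, *Tamagawa numbers*, Ann. of Math. 127 (1988): §2 Theorem 2.
* [Rogawski1990] J. D. Rogawski, *Automorphic Representations of Unitary Groups in Three Variables* (1990): §12.5 pp. 182–187, §12.6 p. 187.
* [BruhatTits1972] F. Bruhat, J. Tits, *Groupes réductifs sur un corps local* I, Publ. Math. IHÉS 41 (1972): §10.
-/

set_option autoImplicit false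
-- the mandated namespace has the single-problem summit's repeated segment (`HodgeConjecture.HodgeConjecture`)
set_option linter.dupNamespace false

noncomputable section

open NumberField IsDedekindDomain MeasureTheory Filter Topology
open scoped Matrix MatrixGroups Pointwise Valued WithZero ComplexConjugate
open Literature.NumberTheory.Rogawski1990 Literature.NumberTheory.Rogawski1990.Ch12Sec5
open Literature.NumberTheory.Automorphic Literature.NumberTheory.Automorphic.UnitaryGroup Literature.NumberTheory.Automorphic.UnitaryLatticeTree
open Literature.NumberTheory.Automorphic.HermitianLattice
open Literature.NumberTheory.GaloisRepresentations
open Literature.Combinatorics.SimpleGraph Literature.Combinatorics.SimpleGraph.OrientedIncidence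

namespace Summit.HodgeConjecture.HodgeConjecture.Cruxes.H413.K2E3K1PseudoCoeffWitnessWild

open Summit.HodgeConjecture.HodgeConjecture.Cruxes.H413
open Summit.HodgeConjecture.HodgeConjecture.Cruxes.H413.F0P3cStCharTSTorusDefs
open Summit.HodgeConjecture.HodgeConjecture.Cruxes.H413.F0P3cStCharTSK1PseudoCoeffWitnessRamified

variable (L : Type) [Field L] [NumberField L] [IsCMField L] (v : HeightOneSpectrum (𝓞 ↥(maximalRealSubfield L)))

set_option maxHeartbeats 1600000 in
-- instance-term unification on the CM local carriers and the vertex subtype (= S2a's own budget, as ★ 41g-H ∕ the 48-datum)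
/-- **«58-WITNESS-WILD» — THE SCHNEIDER–STUHLER EULER–POINCARÉ PSEUDO-COEFFICIENT OF A GENERAL IRREDUCIBLE CLASS, EXPLICIT LETTERS, AT EVERY RAMIFIED PLACE
(tame re-proved, WILD = dyadic new).**  The statement of ★ 58-WITNESS-RAM `isPseudoCoeff_epFunction_of_neg_explicit` with its tame block `(hσ hvσ hϖ hσϖ hres h2 hnorm)` replaced
IN ITS SLOT by `(hram : e(w∣v) ≠ 1) (hϖ)` (ANY uniformiser `ϖ` of `L_w`, no `|2|_w` condition; ★ p855067's token map — the letter is called `hram` here because the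
statement already has a binder `he` = «a level-`e` fixed vector exists»); `h61` (row 61 «ALL principal-series traces of this `f_EP` vanish», discharged by the caller from
61b-W) and the conclusion VERBATIM: for EVERY irreducible `r` with a level-`e` fixed vector and `σ = ⟦r⟧`, `𝔇.IsPseudoCoeff σ (ν(P₀)⁻¹ • f₀ + ν(P₂)⁻¹ • f₂ − ν(P₁)⁻¹ • f₁)`.
Proof = ★ 58-WITNESS-RAM's with its three tame calls swapped for their ★ WILD twins: (c) ★ B3(53)-W `K2E3EllipticFixedTreeWild.ellipticFixedTree_of_mem_ellG_of_ramificationIdx_ne_one`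
(p855224), (d) ★ 48-W∕2 `K2E3EPFunctionOrbitalEllipticWild.classOrbitalIntegral_epSum_eq_fixedVertexSum_sub_fixedEdgeSum_of_ramificationIdx_ne_one` (K2E4-p21), (e) ★ H-W
`K2E3CharacterEllipticUniformWild.char_eq_fixedVertexSum_sub_fixedEdgeSum_of_ramificationIdx_ne_one` (K2E3-p15 p855220); clause 1 ★ row 42, clause 2 ★ (G4) pin reader ∘ ★
47e-E3 (place-free) ∘ `h61`, ★ 51 termwise, (a) ★ H-RAM `actionHom_apply_eq_of_mem_of_adj_of_involution` (`|σ_w ·| = |·|` ★ `valued_galAdicCompletionMap`) — unchanged.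
[cite: SchneiderStuhler1997, Thm. III.4.16, §III.4] [cite: Kottwitz1988, §2 Theorem 2] [cite: Rogawski1990, §12.6 p. 187] [cite: BruhatTits1972, §10] -/
theorem isPseudoCoeff_epFunction_of_ramificationIdx_ne_one_explicit
    (hns : ∀ w : PlacesOver L v, IsCMField.complexConj L • w.1 = w.1)
    (w : PlacesOver L v) (hw : IsCMField.complexConj L • w.1 = w.1) {ϖ : w.1.adicCompletion L}
    (hram : v.asIdeal.ramificationIdx' w.1.asIdeal ≠ 1) (hϖ : Valued.v ϖ = WithZero.exp (-1 : ℤ))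
    (eA : Gqs L v ≃ₜ* ↥(unitaryGroupOfForm (galAdicCompletionMap (L := L) (IsCMField.complexConj L) hw) ((StdForm.antidiagonal 3).over (w.1.adicCompletion L))))
    (heA : ∀ g : Gqs L v, ((eA g : ↥(unitaryGroupOfForm (galAdicCompletionMap (L := L) (IsCMField.complexConj L) hw) ((StdForm.antidiagonal 3).over (w.1.adicCompletion L)))) : GL (Fin 3) (w.1.adicCompletion L)) = ((localNonsplitEquiv (IsCMField.complexConj L) (qsForm L) (IsCMField.complexConj_ne_one L) w hw g : ↥(unitaryGroupOfForm (galAdicCompletionMap (L := L) (IsCMField.complexConj L) hw) (placeForm (qsForm L) w.1))) : GL (Fin 3) (w.1.adicCompletion L)))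
    [MeasurableSpace (Gqs L v)] [BorelSpace (Gqs L v)]
    [∀ γ : Gqs L v, MeasurableSpace (Gqs L v ⧸ Subgroup.centralizer ({γ} : Set (Gqs L v)))] [∀ γ : Gqs L v, BorelSpace (Gqs L v ⧸ Subgroup.centralizer ({γ} : Set (Gqs L v)))]
    [MeasurableSpace (Gqs L v ⧸ Subgroup.center (Gqs L v))]
    {H : Type} [Group H] [TopologicalSpace H] [IsTopologicalGroup H] [MeasurableSpace H]
    (νQv : Measure (Gqs L v)) [νQv.IsHaarMeasure] [νQv.IsMulRightInvariant] (mQv : OrbitalMeasureFamily (Gqs L v))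
    (hcanQ : mQv.IsCanonical (fun γ => IsRegularElt (γ.val : GL (Fin 3) (UnitaryGroup.LocalRing L v))) νQv)
    (𝔇 : EllipticData (Gqs L v) H) (hμG : 𝔇.μG = νQv) (horb : 𝔇.orb = mQv)
    (hreg : ∀ γ : Gqs L v, γ ∈ 𝔇.regG ↔ IsRegularElt (γ.val : GL (Fin 3) (UnitaryGroup.LocalRing L v)))
    (hE : ∀ γ : Gqs L v, γ ∈ 𝔇.ellG ↔ IsRegularElt (γ.val : GL (Fin 3) (UnitaryGroup.LocalRing L v)) ∧ γ ∉ hyperbolicSet L v)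
    (hM1 : ∀ π : IrrClass (Gqs L v), Measurable (𝔇.char π) ∧ LocallyIntegrable (𝔇.char π) 𝔇.μG ∧ (∀ x ∈ 𝔇.regG, ∀ᶠ y in 𝓝 x, 𝔇.char π y = 𝔇.char π x) ∧
      ∀ φ : Gqs L v → ℂ, IsLocSmooth φ → π.smoothTrace 𝔇.μG φ = ∫ x, φ x * 𝔇.char π x ∂𝔇.μG)
    -- ◇ E1 row 61 (F0P2-p06 (g22): 61a `smoothTrace_cmPrincipalSeries_epFunction_eq_zero_of_horocycleData` modulo the horocycle packages, 61b its discharge on ★-to-be 55-B (LH10-p02)):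
    --   the `hsp` supplier at the datum — ALL principal-series traces of `f_EP^{π,e}` vanish — OUTPUT in the 48-datum's 3-TERM letters (census U2, keeper «=» 03:30:09Z);
    --   RESHAPED 04:41:42Z (F0P3a-p04 g32, two antecedent tokens): `(hρ : ρ.IsSmooth) (hVN : FiniteDimensional ℂ ((cmBorelTriple L 3 v).restrict ρ).Coinvariants)` after `(ρ)` — discharged at `r.ρ` by `r.isSmooth` and ★ JDIM2 `F0P3cStCharTSJacquetLine.finrank_coinvariants_le_two`
    (h61 : (∀ g : Gqs L v, ((eA g : ↥(unitaryGroupOfForm (galAdicCompletionMap (L := L) (IsCMField.complexConj L) hw) ((StdForm.antidiagonal 3).over (w.1.adicCompletion L)))) : GL (Fin 3) (w.1.adicCompletion L)) = ((localNonsplitEquiv (IsCMField.complexConj L) (qsForm L) (IsCMField.complexConj_ne_one L) w hw g : ↥(unitaryGroupOfForm (galAdicCompletionMap (L := L) (IsCMField.complexConj L) hw) (placeForm (qsForm L) w.1))) : GL (Fin 3) (w.1.adicCompletion L))) → ∀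
      {a : (Gqs L v) →* ((latticeGraph (galAdicCompletionMap (L := L) (IsCMField.complexConj L) hw) ϖ ((StdForm.antidiagonal 3).over (w.1.adicCompletion L))) ≃g (latticeGraph (galAdicCompletionMap (L := L) (IsCMField.complexConj L) hw) ϖ ((StdForm.antidiagonal 3).over (w.1.adicCompletion L))))} (ha : ∀ g, a g = latticeGraphIso (galAdicCompletionMap (L := L) (IsCMField.complexConj L) hw) ϖ ((StdForm.antidiagonal 3).over (w.1.adicCompletion L)) (eA g))
      (τ : Orientation (latticeGraph (galAdicCompletionMap (L := L) (IsCMField.complexConj L) hw) ϖ ((StdForm.antidiagonal 3).over (w.1.adicCompletion L)))) (hτ : ∀ d, τ.tail d < τ.head d)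
      {e : ℕ} {U : {M : Submodule 𝒪[(w.1.adicCompletion L)] (Fin 3 → (w.1.adicCompletion L)) // IsVertex (galAdicCompletionMap (L := L) (IsCMField.complexConj L) hw) ϖ ((StdForm.antidiagonal 3).over (w.1.adicCompletion L)) M} → Subgroup (Gqs L v)}
      (hU : ∀ x g, g ∈ U x ↔ mapGL ((eA g : ↥(unitaryGroupOfForm (galAdicCompletionMap (L := L) (IsCMField.complexConj L) hw) ((StdForm.antidiagonal 3).over (w.1.adicCompletion L)))) : GL (Fin 3) (w.1.adicCompletion L)) x.1 = x.1 ∧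
      x.1.map ((Matrix.toLin' ((((eA g : ↥(unitaryGroupOfForm (galAdicCompletionMap (L := L) (IsCMField.complexConj L) hw) ((StdForm.antidiagonal 3).over (w.1.adicCompletion L)))) : GL (Fin 3) (w.1.adicCompletion L)) : Matrix (Fin 3) (Fin 3) (w.1.adicCompletion L)) - 1)).restrictScalars 𝒪[(w.1.adicCompletion L)]) ≤ scaleLattice (ϖ ^ (e + 1)) x.1)
      (hUo : ∀ x, IsOpen (U x : Set (Gqs L v))) (hUc : ∀ x, IsCompact (U x : Set (Gqs L v)))
      (hEo : ∀ d : (latticeGraph (galAdicCompletionMap (L := L) (IsCMField.complexConj L) hw) ϖ ((StdForm.antidiagonal 3).over (w.1.adicCompletion L))).edgeSet, IsOpen ((U (τ.head d) ⊔ U (τ.tail d) : Subgroup (Gqs L v)) : Set (Gqs L v)))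
      (hEc : ∀ d : (latticeGraph (galAdicCompletionMap (L := L) (IsCMField.complexConj L) hw) ϖ ((StdForm.antidiagonal 3).over (w.1.adicCompletion L))).edgeSet, IsCompact ((U (τ.head d) ⊔ U (τ.tail d) : Subgroup (Gqs L v)) : Set (Gqs L v)))
      {A : ℤ → {M : Submodule 𝒪[(w.1.adicCompletion L)] (Fin 3 → (w.1.adicCompletion L)) // IsVertex (galAdicCompletionMap (L := L) (IsCMField.complexConj L) hw) ϖ ((StdForm.antidiagonal 3).over (w.1.adicCompletion L)) M}} (hA0 : ∀ c : ℤ, (A (2 * c)).1 = latt (Matrix.diagonal ![ϖ ^ c, (1 : w.1.adicCompletion L), ϖ ^ (-c)])) (hA1 : ∀ c : ℤ, (A (2 * c + 1)).1 = latt (Matrix.diagonal ![ϖ ^ (c + 1), (1 : w.1.adicCompletion L), ϖ ^ (-c)]))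
      (d₁ : (latticeGraph (galAdicCompletionMap (L := L) (IsCMField.complexConj L) hw) ϖ ((StdForm.antidiagonal 3).over (w.1.adicCompletion L))).edgeSet) (hd₁ : (d₁ : Sym2 {M : Submodule 𝒪[(w.1.adicCompletion L)] (Fin 3 → (w.1.adicCompletion L)) // IsVertex (galAdicCompletionMap (L := L) (IsCMField.complexConj L) hw) ϖ ((StdForm.antidiagonal 3).over (w.1.adicCompletion L)) M}) = s(A 0, A 1)) (P₀ P₂ P₁ : Subgroup (Gqs L v))
      (hP₀ : ∀ g, g ∈ P₀ ↔ a g (τ.head d₁) = τ.head d₁) (hP₂ : ∀ g, g ∈ P₂ ↔ a g (τ.tail d₁) = τ.tail d₁) (hP₁ : ∀ g, g ∈ P₁ ↔ (a g).mapEdgeSet d₁ = d₁)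
      {V : Type} [AddCommGroup V] [Module ℂ V] (ρ : Representation ℂ (Gqs L v) V)
      (hρ : ρ.IsSmooth) (hVN : FiniteDimensional ℂ ((cmBorelTriple L 3 v).restrict ρ).Coinvariants)
      [FiniteDimensional ℂ ↥(ρ.fixedPoints (U (τ.head d₁)))] [FiniteDimensional ℂ ↥(ρ.fixedPoints (U (τ.tail d₁)))]
      [FiniteDimensional ℂ ↥(ρ.fixedPoints (U (τ.head d₁) ⊔ U (τ.tail d₁)))]
      (τ₀ : Representation ℂ ↥P₀ ↥(ρ.fixedPoints (U (τ.head d₁))))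
      (hτρ₀ : ∀ (p : ↥P₀) (x : ↥(ρ.fixedPoints (U (τ.head d₁)))), ((τ₀ p x : ↥(ρ.fixedPoints (U (τ.head d₁)))) : V) = ρ (p : (Gqs L v)) (x : V))
      (hτ₀ : ∀ p : ↥P₀, (p : (Gqs L v)) ∈ U (τ.head d₁) → τ₀ p = 1)
      (τ₂ : Representation ℂ ↥P₂ ↥(ρ.fixedPoints (U (τ.tail d₁))))
      (hτρ₂ : ∀ (p : ↥P₂) (x : ↥(ρ.fixedPoints (U (τ.tail d₁)))), ((τ₂ p x : ↥(ρ.fixedPoints (U (τ.tail d₁)))) : V) = ρ (p : (Gqs L v)) (x : V))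
      (hτ₂ : ∀ p : ↥P₂, (p : (Gqs L v)) ∈ U (τ.tail d₁) → τ₂ p = 1)
      (τ₁ : Representation ℂ ↥P₁ ↥(ρ.fixedPoints (U (τ.head d₁) ⊔ U (τ.tail d₁))))
      (hτρ₁ : ∀ (p : ↥P₁) (x : ↥(ρ.fixedPoints (U (τ.head d₁) ⊔ U (τ.tail d₁)))), ((τ₁ p x : ↥(ρ.fixedPoints (U (τ.head d₁) ⊔ U (τ.tail d₁)))) : V) = ρ (p : (Gqs L v)) (x : V))
      (hτ₁ : ∀ p : ↥P₁, (p : (Gqs L v)) ∈ U (τ.head d₁) ⊔ U (τ.tail d₁) → τ₁ p = 1)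
      {f₀ f₂ f₁ : (Gqs L v) → ℂ}
      (hfP₀ : ∀ (g : (Gqs L v)) (hg : g ∈ P₀), f₀ g = Representation.character τ₀ ⟨g, hg⟩⁻¹) (hf0₀ : ∀ g ∉ P₀, f₀ g = 0)
      (hfP₂ : ∀ (g : (Gqs L v)) (hg : g ∈ P₂), f₂ g = Representation.character τ₂ ⟨g, hg⟩⁻¹) (hf0₂ : ∀ g ∉ P₂, f₂ g = 0)
      (hfP₁ : ∀ (g : (Gqs L v)) (hg : g ∈ P₁), f₁ g = Representation.character τ₁ ⟨g, hg⟩⁻¹) (hf0₁ : ∀ g ∉ P₁, f₁ g = 0),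
      ∀ χ : ↥(cmBorelTriple L 3 v).M →* ℂˣ, (Continuous fun t => ((χ t : ℂˣ) : ℂ)) →
        Representation.smoothTrace (G := Gqs L v) (UnitaryGroup.cmPrincipalSeries L 3 v χ) νQv ((((νQv.real (P₀ : Set (Gqs L v)))⁻¹ : ℂ)) • f₀ + (((νQv.real (P₂ : Set (Gqs L v)))⁻¹ : ℂ)) • f₂ - (((νQv.real (P₁ : Set (Gqs L v)))⁻¹ : ℂ)) • f₁) = 0)
    {a : (Gqs L v) →* ((latticeGraph (galAdicCompletionMap (L := L) (IsCMField.complexConj L) hw) ϖ ((StdForm.antidiagonal 3).over (w.1.adicCompletion L))) ≃g (latticeGraph (galAdicCompletionMap (L := L) (IsCMField.complexConj L) hw) ϖ ((StdForm.antidiagonal 3).over (w.1.adicCompletion L))))} (ha : ∀ g, a g = latticeGraphIso (galAdicCompletionMap (L := L) (IsCMField.complexConj L) hw) ϖ ((StdForm.antidiagonal 3).over (w.1.adicCompletion L)) (eA g))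
    (τ : Orientation (latticeGraph (galAdicCompletionMap (L := L) (IsCMField.complexConj L) hw) ϖ ((StdForm.antidiagonal 3).over (w.1.adicCompletion L)))) (hτ : ∀ d, τ.tail d < τ.head d)
    {e : ℕ} {U : {M : Submodule 𝒪[(w.1.adicCompletion L)] (Fin 3 → (w.1.adicCompletion L)) // IsVertex (galAdicCompletionMap (L := L) (IsCMField.complexConj L) hw) ϖ ((StdForm.antidiagonal 3).over (w.1.adicCompletion L)) M} → Subgroup (Gqs L v)}
    (hU : ∀ x g, g ∈ U x ↔ mapGL ((eA g : ↥(unitaryGroupOfForm (galAdicCompletionMap (L := L) (IsCMField.complexConj L) hw) ((StdForm.antidiagonal 3).over (w.1.adicCompletion L)))) : GL (Fin 3) (w.1.adicCompletion L)) x.1 = x.1 ∧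
    x.1.map ((Matrix.toLin' ((((eA g : ↥(unitaryGroupOfForm (galAdicCompletionMap (L := L) (IsCMField.complexConj L) hw) ((StdForm.antidiagonal 3).over (w.1.adicCompletion L)))) : GL (Fin 3) (w.1.adicCompletion L)) : Matrix (Fin 3) (Fin 3) (w.1.adicCompletion L)) - 1)).restrictScalars 𝒪[(w.1.adicCompletion L)]) ≤ scaleLattice (ϖ ^ (e + 1)) x.1)
    (hUo : ∀ x, IsOpen (U x : Set (Gqs L v))) (hUc : ∀ x, IsCompact (U x : Set (Gqs L v)))
    (hEo : ∀ d : (latticeGraph (galAdicCompletionMap (L := L) (IsCMField.complexConj L) hw) ϖ ((StdForm.antidiagonal 3).over (w.1.adicCompletion L))).edgeSet, IsOpen ((U (τ.head d) ⊔ U (τ.tail d) : Subgroup (Gqs L v)) : Set (Gqs L v)))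
    (hEc : ∀ d : (latticeGraph (galAdicCompletionMap (L := L) (IsCMField.complexConj L) hw) ϖ ((StdForm.antidiagonal 3).over (w.1.adicCompletion L))).edgeSet, IsCompact ((U (τ.head d) ⊔ U (τ.tail d) : Subgroup (Gqs L v)) : Set (Gqs L v)))
    {A : ℤ → {M : Submodule 𝒪[(w.1.adicCompletion L)] (Fin 3 → (w.1.adicCompletion L)) // IsVertex (galAdicCompletionMap (L := L) (IsCMField.complexConj L) hw) ϖ ((StdForm.antidiagonal 3).over (w.1.adicCompletion L)) M}} (hA0 : ∀ c : ℤ, (A (2 * c)).1 = latt (Matrix.diagonal ![ϖ ^ c, (1 : w.1.adicCompletion L), ϖ ^ (-c)])) (hA1 : ∀ c : ℤ, (A (2 * c + 1)).1 = latt (Matrix.diagonal ![ϖ ^ (c + 1), (1 : w.1.adicCompletion L), ϖ ^ (-c)]))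
    (d₁ : (latticeGraph (galAdicCompletionMap (L := L) (IsCMField.complexConj L) hw) ϖ ((StdForm.antidiagonal 3).over (w.1.adicCompletion L))).edgeSet) (hd₁ : (d₁ : Sym2 {M : Submodule 𝒪[(w.1.adicCompletion L)] (Fin 3 → (w.1.adicCompletion L)) // IsVertex (galAdicCompletionMap (L := L) (IsCMField.complexConj L) hw) ϖ ((StdForm.antidiagonal 3).over (w.1.adicCompletion L)) M}) = s(A 0, A 1)) (P₀ P₂ P₁ : Subgroup (Gqs L v))
    (hP₀ : ∀ g, g ∈ P₀ ↔ a g (τ.head d₁) = τ.head d₁) (hP₂ : ∀ g, g ∈ P₂ ↔ a g (τ.tail d₁) = τ.tail d₁) (hP₁ : ∀ g, g ∈ P₁ ↔ (a g).mapEdgeSet d₁ = d₁)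
    (r : SmoothIrrep (Gqs L v)) (he : ∃ x₀ : {M : Submodule 𝒪[(w.1.adicCompletion L)] (Fin 3 → (w.1.adicCompletion L)) // IsVertex (galAdicCompletionMap (L := L) (IsCMField.complexConj L) hw) ϖ ((StdForm.antidiagonal 3).over (w.1.adicCompletion L)) M}, r.ρ.fixedPoints (U x₀) ≠ ⊥)
    [FiniteDimensional ℂ ↥(r.ρ.fixedPoints (U (τ.head d₁)))] [FiniteDimensional ℂ ↥(r.ρ.fixedPoints (U (τ.tail d₁)))]
    [FiniteDimensional ℂ ↥(r.ρ.fixedPoints (U (τ.head d₁) ⊔ U (τ.tail d₁)))]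
    (τ₀ : Representation ℂ ↥P₀ ↥(r.ρ.fixedPoints (U (τ.head d₁))))
    (hτρ₀ : ∀ (p : ↥P₀) (x : ↥(r.ρ.fixedPoints (U (τ.head d₁)))), ((τ₀ p x : ↥(r.ρ.fixedPoints (U (τ.head d₁)))) : r.V) = r.ρ (p : (Gqs L v)) (x : r.V))
    (hτ₀ : ∀ p : ↥P₀, (p : (Gqs L v)) ∈ U (τ.head d₁) → τ₀ p = 1)
    (τ₂ : Representation ℂ ↥P₂ ↥(r.ρ.fixedPoints (U (τ.tail d₁))))
    (hτρ₂ : ∀ (p : ↥P₂) (x : ↥(r.ρ.fixedPoints (U (τ.tail d₁)))), ((τ₂ p x : ↥(r.ρ.fixedPoints (U (τ.tail d₁)))) : r.V) = r.ρ (p : (Gqs L v)) (x : r.V))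
    (hτ₂ : ∀ p : ↥P₂, (p : (Gqs L v)) ∈ U (τ.tail d₁) → τ₂ p = 1)
    (τ₁ : Representation ℂ ↥P₁ ↥(r.ρ.fixedPoints (U (τ.head d₁) ⊔ U (τ.tail d₁))))
    (hτρ₁ : ∀ (p : ↥P₁) (x : ↥(r.ρ.fixedPoints (U (τ.head d₁) ⊔ U (τ.tail d₁)))), ((τ₁ p x : ↥(r.ρ.fixedPoints (U (τ.head d₁) ⊔ U (τ.tail d₁)))) : r.V) = r.ρ (p : (Gqs L v)) (x : r.V))
    (hτ₁ : ∀ p : ↥P₁, (p : (Gqs L v)) ∈ U (τ.head d₁) ⊔ U (τ.tail d₁) → τ₁ p = 1)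
    {f₀ f₂ f₁ : (Gqs L v) → ℂ}
    (hfP₀ : ∀ (g : (Gqs L v)) (hg : g ∈ P₀), f₀ g = Representation.character τ₀ ⟨g, hg⟩⁻¹) (hf0₀ : ∀ g ∉ P₀, f₀ g = 0)
    (hfP₂ : ∀ (g : (Gqs L v)) (hg : g ∈ P₂), f₂ g = Representation.character τ₂ ⟨g, hg⟩⁻¹) (hf0₂ : ∀ g ∉ P₂, f₂ g = 0)
    (hfP₁ : ∀ (g : (Gqs L v)) (hg : g ∈ P₁), f₁ g = Representation.character τ₁ ⟨g, hg⟩⁻¹) (hf0₁ : ∀ g ∉ P₁, f₁ g = 0)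
    (σ : IrrClass (Gqs L v)) (hr : IrrClass.mk r = σ) :
    𝔇.IsPseudoCoeff σ ((((νQv.real (P₀ : Set (Gqs L v)))⁻¹ : ℂ)) • f₀ + (((νQv.real (P₂ : Set (Gqs L v)))⁻¹ : ℂ)) • f₂ - (((νQv.real (P₁ : Set (Gqs L v)))⁻¹ : ℂ)) • f₁) := by
  have hvσ : ∀ x, Valued.v ((galAdicCompletionMap (L := L) (IsCMField.complexConj L) hw) x) = Valued.v x := fun x =>
    valued_galAdicCompletionMap (L := L) (IsCMField.complexConj L) hw x
  subst hr
  classical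
  -- (R) instances, admissibility
  haveI : r.ρ.IsIrreducible := r.isIrreducible
  haveI : NonarchimedeanGroup (Gqs L v) :=
    nonarchimedeanGroup_unitaryGroupOfForm_local (E := L) (c := IsCMField.complexConj L) (N := 3) (v := v) (J' := (adelicForm L 3 (qsForm L)).map (adeleToLocal L v))
  haveI := compactSpace_integer_adicCompletion L w.1
  have hadm : r.ρ.IsAdmissible := F0P3cStCharTSScTracePackage.isAdmissible_smoothIrrep L v hns r
  have hσc : Continuous (galAdicCompletionMap (L := L) (IsCMField.complexConj L) hw) := continuous_galAdicCompletionMap L (IsCMField.complexConj L) hw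
  -- edges: fixed iff both ends fixed (★ invariant orientation, §0)
  have hσa : ∀ (g : Gqs L v) (d : (latticeGraph (galAdicCompletionMap (L := L) (IsCMField.complexConj L) hw) ϖ ((StdForm.antidiagonal 3).over (w.1.adicCompletion L))).edgeSet), τ.head ((a g).mapEdgeSet d) = a g (τ.head d) ∧ τ.tail ((a g).mapEdgeSet d) = a g (τ.tail d) := fun g d => by
    rw [ha]; exact head_mapEdgeSet_latticeGraphIso (galAdicCompletionMap (L := L) (IsCMField.complexConj L) hw) ϖ ((StdForm.antidiagonal 3).over (w.1.adicCompletion L)) hτ (eA g) d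
  have hfixE : ∀ (g : Gqs L v) (d : (latticeGraph (galAdicCompletionMap (L := L) (IsCMField.complexConj L) hw) ϖ ((StdForm.antidiagonal 3).over (w.1.adicCompletion L))).edgeSet), (a g).mapEdgeSet d = d ↔ a g (τ.head d) = τ.head d ∧ a g (τ.tail d) = τ.tail d := fun g d =>
    F0P3cStCharTSEPFunctionOrbitalOrbits.mapEdgeSet_eq_iff L v w hw eA ha τ hτ g d
  -- stabilisers are compact open (★ FILE P through `eA`); the given `P₀ P₂ P₁` are stabilisers
  have hstab : ∀ x : {M : Submodule 𝒪[(w.1.adicCompletion L)] (Fin 3 → (w.1.adicCompletion L)) // IsVertex (galAdicCompletionMap (L := L) (IsCMField.complexConj L) hw) ϖ ((StdForm.antidiagonal 3).over (w.1.adicCompletion L)) M}, ∃ P : Subgroup (Gqs L v), (∀ g, g ∈ P ↔ a g x = x) ∧ IsOpen (P : Set (Gqs L v)) ∧ IsCompact (P : Set (Gqs L v)) := fun x => by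
    obtain ⟨Q, hQ⟩ := exists_stabilizerSubgroup (galAdicCompletionMap (L := L) (IsCMField.complexConj L) hw) ϖ ((StdForm.antidiagonal 3).over (w.1.adicCompletion L)) x
    have hmem : ∀ g : Gqs L v, g ∈ Q.comap eA.toMonoidHom ↔ a g x = x := fun g => by
      rw [F0P3cStCharTSCharacterEllipticUniform.mem_comap_iff', hQ, ha]
    refine ⟨Q.comap eA.toMonoidHom, hmem, ?_, ?_⟩
    · have hset : ((Q.comap eA.toMonoidHom : Subgroup (Gqs L v)) : Set (Gqs L v)) = {g : Gqs L v | a g x = x} := Set.ext hmem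
      rw [hset]; exact F0P3cStCharTSCharacterEllipticUniform.isOpen_setOf_actionHom_apply_eq ha x
    · have hset : (Q : Set ↥(unitaryGroupOfForm (galAdicCompletionMap (L := L) (IsCMField.complexConj L) hw) ((StdForm.antidiagonal 3).over (w.1.adicCompletion L)))) = {u | latticeGraphIso (galAdicCompletionMap (L := L) (IsCMField.complexConj L) hw) ϖ ((StdForm.antidiagonal 3).over (w.1.adicCompletion L)) u x = x} := Set.ext hQ
      refine F0P3cStCharTSCharacterEllipticUniform.isCompact_coe_comap eA Q ?_
      rw [hset]
      exact isCompact_setOf_latticeGraphIso_apply_eq (galAdicCompletionMap (L := L) (IsCMField.complexConj L) hw) ϖ ((StdForm.antidiagonal 3).over (w.1.adicCompletion L)) hσc x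
  have hoc : ∀ (P : Subgroup (Gqs L v)) (x : {M : Submodule 𝒪[(w.1.adicCompletion L)] (Fin 3 → (w.1.adicCompletion L)) // IsVertex (galAdicCompletionMap (L := L) (IsCMField.complexConj L) hw) ϖ ((StdForm.antidiagonal 3).over (w.1.adicCompletion L)) M}), (∀ g, g ∈ P ↔ a g x = x) → IsOpen (P : Set (Gqs L v)) ∧ IsCompact (P : Set (Gqs L v)) := fun P x hP => by
    obtain ⟨Q, hQ, hQo, hQc⟩ := hstab x
    have hPQ : (P : Set (Gqs L v)) = (Q : Set (Gqs L v)) := Set.ext fun g => (hP g).trans (hQ g).symm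
    rw [hPQ]; exact ⟨hQo, hQc⟩
  have hP₀c : IsCompact (P₀ : Set (Gqs L v)) := (hoc P₀ _ hP₀).2
  have hP₂c : IsCompact (P₂ : Set (Gqs L v)) := (hoc P₂ _ hP₂).2
  have hP₁c : IsCompact (P₁ : Set (Gqs L v)) := by
    have h12 : (P₁ : Set (Gqs L v)) = (P₀ : Set (Gqs L v)) ∩ (P₂ : Set (Gqs L v)) := Set.ext fun g => by
      rw [SetLike.mem_coe, hP₁, hfixE, Set.mem_inter_iff, SetLike.mem_coe, SetLike.mem_coe, hP₀, hP₂]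
    rw [h12]
    exact hP₀c.inter_right (P₂.isClosed_of_isOpen (hoc P₂ _ hP₂).1)
  -- level groups inside stabilisers (★ (U1), level ≥ 1 fixes the closed star), stabilisers inside normalisers (★ (U3))
  have hUP₀ : U (τ.head d₁) ≤ P₀ := fun g hg => (hP₀ g).2 (F0P3cStCharTSCharacterEllipticUniform.actionHom_apply_eq_of_mem ha hU hg)
  have hUP₂ : U (τ.tail d₁) ≤ P₂ := fun g hg => (hP₂ g).2 (F0P3cStCharTSCharacterEllipticUniform.actionHom_apply_eq_of_mem ha hU hg)
  have hUP₁ : U (τ.head d₁) ⊔ U (τ.tail d₁) ≤ P₁ := by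
    refine sup_le (fun g hg => (hP₁ g).2 ((hfixE g d₁).2 ⟨?_, ?_⟩)) (fun g hg => (hP₁ g).2 ((hfixE g d₁).2 ⟨?_, ?_⟩))
    · exact F0P3cStCharTSCharacterEllipticUniform.actionHom_apply_eq_of_mem ha hU hg
    · exact F0P3cStCharTSCharacterEllipticUniformRamified.actionHom_apply_eq_of_mem_of_adj_of_involution ha hU hvσ hϖ hg (τ.adj_head_tail d₁)
    · exact F0P3cStCharTSCharacterEllipticUniformRamified.actionHom_apply_eq_of_mem_of_adj_of_involution ha hU hvσ hϖ hg (τ.adj_head_tail d₁).symm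
    · exact F0P3cStCharTSCharacterEllipticUniform.actionHom_apply_eq_of_mem ha hU hg
  have hPU₀ : P₀ ≤ Subgroup.normalizer ((U (τ.head d₁) : Subgroup (Gqs L v)) : Set (Gqs L v)) := fun g hg =>
    F0P3cStCharTSCharacterEllipticUniform.mem_normalizer_unitaryLevel_gqs_of_apply_eq ha hU ((hP₀ g).1 hg)
  have hPU₂ : P₂ ≤ Subgroup.normalizer ((U (τ.tail d₁) : Subgroup (Gqs L v)) : Set (Gqs L v)) := fun g hg =>
    F0P3cStCharTSCharacterEllipticUniform.mem_normalizer_unitaryLevel_gqs_of_apply_eq ha hU ((hP₂ g).1 hg)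
  have hPUE : ∀ (P : Subgroup (Gqs L v)) (d : (latticeGraph (galAdicCompletionMap (L := L) (IsCMField.complexConj L) hw) ϖ ((StdForm.antidiagonal 3).over (w.1.adicCompletion L))).edgeSet), (∀ g ∈ P, a g (τ.head d) = τ.head d ∧ a g (τ.tail d) = τ.tail d) →
      P ≤ Subgroup.normalizer ((U (τ.head d) ⊔ U (τ.tail d) : Subgroup (Gqs L v)) : Set (Gqs L v)) := fun P d hP g hg =>
    Subgroup.normalizer_inf_normalizer_le_normalizer_sup (U (τ.head d)) (U (τ.tail d))
      (Subgroup.mem_inf.2 ⟨F0P3cStCharTSCharacterEllipticUniform.mem_normalizer_unitaryLevel_gqs_of_apply_eq ha hU (hP g hg).1,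
        F0P3cStCharTSCharacterEllipticUniform.mem_normalizer_unitaryLevel_gqs_of_apply_eq ha hU (hP g hg).2⟩)
  have hPU₁ : P₁ ≤ Subgroup.normalizer ((U (τ.head d₁) ⊔ U (τ.tail d₁) : Subgroup (Gqs L v)) : Set (Gqs L v)) :=
    hPUE P₁ d₁ fun g hg => (hfixE g d₁).1 ((hP₁ g).1 hg)
  -- CLAUSE 1 (★ row 42): `f_EP ∈ C_c^∞(G_v)`
  have hSB : ((((νQv.real (P₀ : Set (Gqs L v)))⁻¹ : ℂ)) • f₀ + (((νQv.real (P₂ : Set (Gqs L v)))⁻¹ : ℂ)) • f₂ - (((νQv.real (P₁ : Set (Gqs L v)))⁻¹ : ℂ)) • f₁) ∈ SchwartzBruhat (Gqs L v) :=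
    Submodule.sub_mem _
      (Submodule.add_mem _
        (Submodule.smul_mem _ _ (Representation.mem_schwartzBruhat_of_kType (hUo _) (hUc _) hP₀c hUP₀ hPU₀ τ₀ (fun u hu => hτ₀ ⟨u, hUP₀ hu⟩ hu) hfP₀ hf0₀))
        (Submodule.smul_mem _ _ (Representation.mem_schwartzBruhat_of_kType (hUo _) (hUc _) hP₂c hUP₂ hPU₂ τ₂ (fun u hu => hτ₂ ⟨u, hUP₂ hu⟩ hu) hfP₂ hf0₂)))
      (Submodule.smul_mem _ _ (Representation.mem_schwartzBruhat_of_kType (hEo d₁) (hEc d₁) hP₁c hUP₁ hPU₁ τ₁ (fun u hu => hτ₁ ⟨u, hUP₁ hu⟩ hu) hfP₁ hf0₁))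
  refine ⟨hSB, ?_, ?_⟩
  · -- CLAUSE 2 (off `G^e`): ★ (G4) pin reader ∘ ★ 47e-E3 ∘ `h61`
    intro γ hγ
    exact F0P3cStCharTSEllMassG.orbInt_eq_zero_of_mem_regG_of_not_mem_ellG L v hns 𝔇 horb hreg hE
      (fun γ' hreg' hnc' => F0P3cStCharTSEPNonEllipticVanishing.classOrbitalIntegral_eq_zero_of_forall_smoothTrace_eq_zero L v hns νQv mQv hcanQ _
        (mem_schwartzBruhat_iff.1 hSB).1 (mem_schwartzBruhat_iff.1 hSB).2
        (h61 heA ha τ hτ hU hUo hUc hEo hEc hA0 hA1 d₁ hd₁ P₀ P₂ P₁ hP₀ hP₂ hP₁ r.ρ r.isSmooth (F0P3cStCharTSJacquetLine.finrank_coinvariants_le_two L v hns r).1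
          τ₀ hτρ₀ hτ₀ τ₂ hτρ₂ hτ₂ τ₁ hτρ₁ hτ₁ hfP₀ hf0₀ hfP₂ hf0₂ hfP₁ hf0₁) hreg' hnc')
      hγ.1 hγ.2
  · -- CLAUSE 3 (on `G^e`): ★ 53 (H5) + ★ 48-datum FILE 2 + ★ 51 termwise + ★ 41g-H
    intro γ hγ
    obtain ⟨hγreg, hΩ⟩ := (hE γ).1 hγ
    have hγr : γ ∈ 𝔇.regG := (hreg γ).2 hγreg
    have hell : IsCompact ((Subgroup.centralizer ({γ} : Set (Gqs L v))) : Set (Gqs L v)) :=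
      F0P3cStCharTSEllCartanCompact.isCompact_centralizer_of_not_mem_hyperbolicSet L v hns hγreg hΩ
    obtain ⟨hne, hfin, hfinE⟩ := K2E3EllipticFixedTreeWild.ellipticFixedTree_of_mem_ellG_of_ramificationIdx_ne_one L v w hw eA ha hns hram hϖ τ hτ 𝔇 hE hγ
    -- ★ 51 termwise: `Θ_U(γ⁻¹) = conj Θ_U(γ)` on the compact stabilisers
    have hu1 : ∀ x ∈ hfin.toFinset, r.ρ.levelTrace (hUo x) (hUc x) γ⁻¹ = (starRingEnd ℂ) (r.ρ.levelTrace (hUo x) (hUc x) γ) := fun x hx => by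
      have hx' : a γ x = x := by simpa using hx
      obtain ⟨Px, hPx, -, hPxc⟩ := hstab x
      exact r.ρ.levelTrace_inv_eq_conj_of_mem_of_isCompact (hUo x) (hUc x) (P := Px)
        (fun g hg => F0P3cStCharTSCharacterEllipticUniform.mem_normalizer_unitaryLevel_gqs_of_apply_eq ha hU ((hPx g).1 hg)) hPxc ((hPx γ).2 hx')
    have hu2 : ∀ d ∈ hfinE.toFinset, r.ρ.levelTrace (hEo d) (hEc d) γ⁻¹ = (starRingEnd ℂ) (r.ρ.levelTrace (hEo d) (hEc d) γ) := fun d hdd => by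
      have hd' : (a γ).mapEdgeSet d = d := by simpa using hdd
      obtain ⟨Ph, hPh, -, hPhc⟩ := hstab (τ.head d)
      obtain ⟨Pt, hPt, hPto, hPtc⟩ := hstab (τ.tail d)
      refine r.ρ.levelTrace_inv_eq_conj_of_mem_of_isCompact (hEo d) (hEc d) (P := Ph ⊓ Pt)
        (hPUE (Ph ⊓ Pt) d fun g hg => ⟨(hPh g).1 (Subgroup.mem_inf.1 hg).1, (hPt g).1 (Subgroup.mem_inf.1 hg).2⟩) ?_
        (Subgroup.mem_inf.2 ⟨(hPh γ).2 ((hfixE γ d).1 hd').1, (hPt γ).2 ((hfixE γ d).1 hd').2⟩)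
      rw [Subgroup.coe_inf]
      exact hPhc.inter_right (Pt.isClosed_of_isOpen hPto)
    have key : ∀ {ι κ : Type} (s₁ : Finset ι) (s₂ : Finset κ) (F₁ G₁ : ι → ℂ) (F₂ G₂ : κ → ℂ),
        (∀ x ∈ s₁, F₁ x = (starRingEnd ℂ) (G₁ x)) → (∀ d ∈ s₂, F₂ d = (starRingEnd ℂ) (G₂ d)) →
        (∑ x ∈ s₁, F₁ x) - ∑ d ∈ s₂, F₂ d = (starRingEnd ℂ) ((∑ x ∈ s₁, G₁ x) - ∑ d ∈ s₂, G₂ d) := by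
      intro ι κ s₁ s₂ F₁ G₁ F₂ G₂ e₁ e₂
      rw [map_sub, map_sum, map_sum, Finset.sum_congr rfl e₁, Finset.sum_congr rfl e₂]
    rw [EllipticData.orbInt, horb,
      K2E3EPFunctionOrbitalEllipticWild.classOrbitalIntegral_epSum_eq_fixedVertexSum_sub_fixedEdgeSum_of_ramificationIdx_ne_one L v w hw hram hϖ eA ha νQv hcanQ τ hτ hU hUo hUc hEo hEc d₁ P₀ P₂ P₁
        hP₀ hP₂ hP₁ r.ρ τ₀ hτρ₀ hτ₀ τ₂ hτρ₂ hτ₂ τ₁ hτρ₁ hτ₁ hfP₀ hf0₀ hfP₂ hf0₂ hfP₁ hf0₁ hγreg hell hfin hfinE,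
      K2E3CharacterEllipticUniformWild.char_eq_fixedVertexSum_sub_fixedEdgeSum_of_ramificationIdx_ne_one L v hns w hw hram hϖ eA νQv 𝔇 hμG r (hM1 (IrrClass.mk r)).2.2.2 ha τ hτ hU hUo hUc
        hEo hEc he hne hfin hfinE ((hM1 (IrrClass.mk r)).2.2.1 γ hγr)]
    exact key hfin.toFinset hfinE.toFinset (fun x => r.ρ.levelTrace (hUo x) (hUc x) γ⁻¹) (fun x => r.ρ.levelTrace (hUo x) (hUc x) γ)
      (fun d => r.ρ.levelTrace (hEo d) (hEc d) γ⁻¹) (fun d => r.ρ.levelTrace (hEo d) (hEc d) γ) hu1 hu2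

end Summit.HodgeConjecture.HodgeConjecture.Cruxes.H413.K2E3K1PseudoCoeffWitnessWild

end
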